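import Summits.Ventures.YMGap.RobustBall.StarDoorZdW
import HarnessLib

/-!
# Venture YMGap, track ROBUST-BALL (Y2) — crux «Y2-X2-P», STEP 3 / P1: THE STAR DOOR WITH A LOGARITHMIC REACH —
# uniqueness and POWER-LAW covariance decay of every Gibbs measure from the weighted star window bound with weight `(1 + (‖y−s‖+1)/D₀)^q`

HONEST FRAMING. WHAT THIS IS: a venture file (cell `pub-ymgap`, track Y2 ROBUST-BALL, seat ds-2 (g14); lead R390 (B) STEP 3, plan line INBOX
2026-08-25 09:56Z; 0 compute). The tree's weighted star window bound `StarWindowBoundZdW d N γ t ρ reach r` (`StarDoorZdW.lean`) carries an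
ARBITRARY reach function, but its two closers (`hasUniqueGibbsMeasure_of_starWindowBoundZdW`, `abs_covariance_le_of_starWindowBoundZdW`) assume
the reach DOMINATES the sup-distance — the exponential (tier-2) regime. Here the SAME Literature engine (the weighted Dobrushin–Shlosman window
comparison of infinite range, `DobrushinShlosmanWeightedInfiniteVolume(States).lean`, which allows any reach `d(c;y,x) ≥ 0` and any profile with
`ρ x ≤ ρ y + d(c;y,x)`) is run with the LOGARITHMIC reach `log(1 + (‖y − s‖_∞ + 1)/D₀)` at rate `q` — i.e. the POLYNOMIAL weight
`(1 + (‖y − s‖_∞ + 1)/D₀)^q` on the received sums — and the logarithmic profiles `log max(1, ρ₀/D₀)` of the tier-2 linear profiles `ρ₀`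
(`exists_starExhaustionW`, `exists_starProfileW`), admissible by the elementary inequality `max(1,(b+r)/D₀) ≤ max(1,b/D₀)·(1+r/D₀)`:
* `hasUniqueGibbsMeasure_of_starWindowBoundZd_log` — UNIQUENESS of the Gibbs measure (`q > 0`, received sum `< 1`);
* ★ `abs_covariance_le_of_starWindowBoundZd_log` — every Gibbs measure satisfies, for bounded measurable `f, g` reading finite link sets with
  Frobenius-Lipschitz vectors, `|cov(f,g)| ≤ 2(2√N)² · max(1, (dist(Δf,Δg) − 2)/D₀)^{−q} (Σδf)(Σδg)` — POWER-LAW decay of exponent `q` beyond the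
  scale `D₀`; and the cleaned form `≤ 2(2√N)² (D₀ + 3)^q (1 + dist)^{−q} (Σδf)(Σδg)` (`abs_covariance_le_of_starWindowBoundZd_log'`).
This is the door-level engine of the tier-3 (power-law) ball; the array with polynomially summable far rows is built in the next files.
WHAT THIS IS NOT: no array, no cell, no number; power-law clustering is WEAKER than a mass gap (the words «mass gap» are not used for tier 3);
strong-coupling LATTICE bookkeeping; nothing about the continuum or the Millennium problem.
-/

noncomputable section

open MeasureTheory ProbabilityTheory Function Finset Real
open scoped NNReal
open Literature.Probability.LatticeModels
open Literature.Probability.LatticeModels.DobrushinMetric (IsLipBound)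
open Literature.MathematicalPhysics.QuantumLattice
open Literature.MathematicalPhysics.QuantumFieldTheory (suFrobDist suFrobDist_nonneg suFrobDist_le
  suFrobDist_self suEntries dist_suEntries_le_suFrobDist measurableSpace_specialUnitaryGroup_eq_comap
  setDistEdges linkSetDist setDistEdges_nonneg)
open Summit.Ventures.YMGap.DSWindowZd

namespace Summit.Ventures.YMGap.RobustBall

variable {d N : ℕ}

/-! ### The logarithmic transform of a linear profile -/

/-- `max(1, (b + r)/D₀) ≤ max(1, b/D₀) · (1 + r/D₀)` for `r ≥ 0`, `D₀ > 0`. [folklore] -/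
theorem max_one_div_add_le {D₀ b r : ℝ} (hD : 0 < D₀) (hr : 0 ≤ r) :
    max 1 ((b + r) / D₀) ≤ max 1 (b / D₀) * (1 + r / D₀) := by
  have hr' : 0 ≤ r / D₀ := div_nonneg hr hD.le
  have hM : 1 ≤ max 1 (b / D₀) := le_max_left _ _
  refine max_le ?_ ?_
  · calc (1 : ℝ) = 1 * 1 := (one_mul _).symm
      _ ≤ max 1 (b / D₀) * (1 + r / D₀) := mul_le_mul hM (by linarith) zero_le_one (by linarith)
  · rw [add_div]
    calc b / D₀ + r / D₀ ≤ max 1 (b / D₀) + max 1 (b / D₀) * (r / D₀) := by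
          have h1 : b / D₀ ≤ max 1 (b / D₀) := le_max_right _ _
          have h2 : r / D₀ ≤ max 1 (b / D₀) * (r / D₀) := by
            calc r / D₀ = 1 * (r / D₀) := (one_mul _).symm
              _ ≤ max 1 (b / D₀) * (r / D₀) := mul_le_mul_of_nonneg_right hM hr'
          linarith
      _ = max 1 (b / D₀) * (1 + r / D₀) := by ring

/-- The logarithmic transform is admissible: `a ≤ b + r`, `r ≥ 0` ⇒ `log max(1, a/D₀) ≤ log max(1, b/D₀) + log(1 + r/D₀)`. [folklore] -/
theorem log_max_one_div_le_add {D₀ a b r : ℝ} (hD : 0 < D₀) (hr : 0 ≤ r) (h : a ≤ b + r) :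
    Real.log (max 1 (a / D₀)) ≤ Real.log (max 1 (b / D₀)) + Real.log (1 + r / D₀) := by
  have h1 : (0 : ℝ) < max 1 (a / D₀) := lt_of_lt_of_le one_pos (le_max_left _ _)
  have h2 : (0 : ℝ) < max 1 (b / D₀) := lt_of_lt_of_le one_pos (le_max_left _ _)
  have h3 : (0 : ℝ) < 1 + r / D₀ := by have := div_nonneg hr hD.le; linarith
  rw [← Real.log_mul h2.ne' h3.ne']
  refine Real.log_le_log h1 ?_
  calc max 1 (a / D₀) ≤ max 1 ((b + r) / D₀) := max_le_max le_rfl (div_le_div_of_nonneg_right h hD.le)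
    _ ≤ max 1 (b / D₀) * (1 + r / D₀) := max_one_div_add_le hD hr

/-- Nonpositive linear profiles have zero logarithmic transform: `u ≤ 0 ⇒ log max(1, u/D₀) = 0 ≤ 0`. [folklore] -/
theorem log_max_one_div_nonpos {D₀ u : ℝ} (hD : 0 < D₀) (hu : u ≤ 0) : Real.log (max 1 (u / D₀)) ≤ 0 := by
  have : u / D₀ ≤ 1 := (div_nonpos_of_nonpos_of_nonneg hu hD.le).trans zero_le_one
  rw [max_eq_left this, Real.log_one]

/-- A link of the vertex star of `s` is within reach `‖y − s‖ + 1` of every link `y`. [folklore] -/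
theorem norm_sub_le_norm_sub_add_one {s : Site d} {x : ZdEdge d} (hx : x ∈ vertexStarZd s) (y : ZdEdge d) :
    ‖x.1 - y.1‖ ≤ ‖y.1 - s‖ + 1 := by
  have h1 := norm_sub_le_one_of_mem_vertexStarZd hx
  calc ‖x.1 - y.1‖ = ‖(x.1 - s) - (y.1 - s)‖ := by congr 1; abel
    _ ≤ ‖x.1 - s‖ + ‖y.1 - s‖ := norm_sub_le _ _
    _ ≤ ‖y.1 - s‖ + 1 := by linarith

/-! ### Exhaustion and two-set profiles for the logarithmic reach -/

/-- **Exhaustion for the star windows, logarithmic reach.** For every finite `Δ` and level `m` there are a finite `Λ ⊇ Δ` and a profile `ρ`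
(the logarithmic transform `log max(1, ρ₀/D₀)` of the linear exhaustion profile of `exists_starExhaustionW`) with: `ρ ≤ 0` off `Λ`; `ρ ≤ 0` on
the links of `Λ` covered by no star `⊆ Λ`; `ρ x ≤ ρ y + log(1 + (‖y − c‖ + 1)/D₀)` along every star; `ρ ≥ m` on `Δ`. [folklore] -/
theorem exists_starExhaustionLog {D₀ : ℝ} (hD : 0 < D₀) (K : Site d → ZdEdge d → ZdEdge d → ℝ)
    (Δ : Finset (ZdEdge d)) (m : ℕ) :
    ∃ (Λ : Finset (ZdEdge d)) (ρ : ZdEdge d → ℝ), Δ ⊆ Λ ∧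
      (∀ y, y ∉ Λ → ρ y ≤ 0) ∧ (∀ x ∈ Λ, (∀ c ∈ Λ, starWinZd c ⊆ Λ → x ∉ starWinZd c) → ρ x ≤ 0) ∧
      (∀ c ∈ Λ, starWinZd c ⊆ Λ → ∀ x ∈ starWinZd c, ∀ y, K c.1 y x ≠ 0 →
        ρ x ≤ ρ y + Real.log (1 + (‖y.1 - c.1‖ + 1) / D₀)) ∧
      (∀ x ∈ Δ, (m : ℝ) ≤ ρ x) := by
  obtain ⟨Λ, ρ₀, hΔ, hout, hunc, hlip, hm⟩ := exists_starExhaustionW (fun s y => ‖y.1 - s‖ + 1)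
    (fun s x hx y => norm_sub_le_norm_sub_add_one hx y) K Δ (⌈D₀ * Real.exp m⌉₊)
  refine ⟨Λ, fun x => Real.log (max 1 (ρ₀ x / D₀)), hΔ, fun y hy => log_max_one_div_nonpos hD (hout y hy),
    fun x hx h => log_max_one_div_nonpos hD (hunc x hx h), ?_, ?_⟩
  · intro c hc hsub x hx y hK
    exact log_max_one_div_le_add hD (by positivity) (hlip c hc hsub x hx y hK)
  · intro x hx
    have h1 : D₀ * Real.exp m ≤ ρ₀ x := (Nat.le_ceil _).trans (hm x hx)
    have h2 : Real.exp m ≤ ρ₀ x / D₀ := by rw [le_div_iff₀ hD]; linarith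
    have h3 : Real.exp m ≤ max 1 (ρ₀ x / D₀) := h2.trans (le_max_right _ _)
    calc (m : ℝ) = Real.log (Real.exp m) := (Real.log_exp _).symm
      _ ≤ Real.log (max 1 (ρ₀ x / D₀)) := Real.log_le_log (Real.exp_pos _) h3

/-- **The two-set profile, logarithmic reach.** For finite `Δf, Δg` there are a finite `Λ ⊇ Δf` and a profile `ρ` (the logarithmic transform of
the linear two-set profile of `exists_starProfileW`) with: `ρ ≤ 0` off `Λ`; `ρ ≤ 0` on the links of `Λ` in no star `⊆ Λ` avoiding `Δg`;
`ρ x ≤ ρ y + log(1 + (‖y − c‖ + 1)/D₀)` along every star; and `ρ ≥ log max(1, (dist(Δf, Δg) − 2)/D₀)` on `Δf`. [folklore] -/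
theorem exists_starProfileLog {D₀ : ℝ} (hD : 0 < D₀) (K : Site d → ZdEdge d → ZdEdge d → ℝ)
    (Δf Δg : Finset (ZdEdge d)) :
    ∃ (Λ : Finset (ZdEdge d)) (ρ : ZdEdge d → ℝ), Δf ⊆ Λ ∧
      (∀ y, y ∉ Λ → ρ y ≤ 0) ∧
      (∀ x ∈ Λ, (∀ c ∈ Λ, starWinZd c ⊆ Λ → (∀ z ∈ starWinZd c, z ∉ Δg) → x ∉ starWinZd c) → ρ x ≤ 0) ∧
      (∀ c ∈ Λ, starWinZd c ⊆ Λ → (∀ z ∈ starWinZd c, z ∉ Δg) → ∀ x ∈ starWinZd c, ∀ y,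
        K c.1 y x ≠ 0 → ρ x ≤ ρ y + Real.log (1 + (‖y.1 - c.1‖ + 1) / D₀)) ∧
      (∀ x ∈ Δf, Real.log (max 1 ((setDistEdges Δf Δg - 2) / D₀)) ≤ ρ x) := by
  obtain ⟨Λ, ρ₀, hΔ, hout, hunc, hlip, hm⟩ := exists_starProfileW (fun s y => ‖y.1 - s‖ + 1)
    (fun s x hx y => norm_sub_le_norm_sub_add_one hx y) K Δf Δg
  refine ⟨Λ, fun x => Real.log (max 1 (ρ₀ x / D₀)), hΔ, fun y hy => log_max_one_div_nonpos hD (hout y hy),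
    fun x hx h => log_max_one_div_nonpos hD (hunc x hx h), ?_, ?_⟩
  · intro c hc hsub havoid x hx y hK
    exact log_max_one_div_le_add hD (by positivity) (hlip c hc hsub havoid x hx y hK)
  · intro x hx
    have h1 : (0 : ℝ) < max 1 ((setDistEdges Δf Δg - 2) / D₀) := lt_of_lt_of_le one_pos (le_max_left _ _)
    exact Real.log_le_log h1 (max_le_max le_rfl (div_le_div_of_nonneg_right (hm x hx) hD.le))

/-! ### The door with logarithmic reach: uniqueness and power-law clustering of every Gibbs measure -/

/-- **UNIQUENESS through the star door with LOGARITHMIC reach.** A specification `γ` on the links of `ℤ^d` with `SU(N)` spins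
(`IsSpecification`, at least one Gibbs measure) carrying the weighted star window bound at rate `q > 0` with received sum `ρ < 1` for the
reach `log(1 + (‖y − s‖ + 1)/D₀)` (weights `(1 + (‖y − s‖ + 1)/D₀)^q`), Frobenius weight, has exactly one Gibbs measure
(Literature `DobrushinShlosman.subsingleton_gibbsMeasures_of_window_weighted`; logarithmic exhaustion `exists_starExhaustionLog`). [folklore] -/
theorem hasUniqueGibbsMeasure_of_starWindowBoundZd_log {γ : Specification (ZdEdge d) (SUN N)}
    (hγ : IsSpecification γ) (hne : (gibbsMeasures γ).Nonempty) {q ρ D₀ : ℝ} (hq : 0 < q) (hD : 0 < D₀)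
    (hρ0 : 0 ≤ ρ) (hρ1 : ρ < 1)
    (h : StarWindowBoundZdW d N γ q ρ (fun s y => Real.log (1 + (‖y.1 - s‖ + 1) / D₀)) suFrobDist) :
    HasUniqueGibbsMeasure γ := by
  classical
  haveI : SecondCountableTopology (Matrix (Fin N) (Fin N) ℂ) :=
    inferInstanceAs (SecondCountableTopology (Fin N → Fin N → ℂ))
  haveI : SecondCountableTopology (SUN N) := Topology.IsEmbedding.subtypeVal.secondCountableTopology
  obtain ⟨K, hK0, hKs, hcontract, hsum⟩ := h
  have hR₀ : (0 : ℝ) ≤ 2 * Real.sqrt N := by positivity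
  have hA : ∀ a b : SUN N, dist (suEntries a) (suEntries b) ≤ 1 * suFrobDist a b := fun a b => by
    rw [one_mul]; exact dist_suEntries_le_suFrobDist a b
  have hreach0 : ∀ (s : Site d) (y : ZdEdge d), 0 ≤ Real.log (1 + (‖y.1 - s‖ + 1) / D₀) := fun s y =>
    Real.log_nonneg (by have := div_nonneg (by positivity : (0 : ℝ) ≤ ‖y.1 - s‖ + 1) hD.le; linarith)
  refine ⟨?_, hne⟩
  exact DobrushinShlosman.subsingleton_gibbsMeasures_of_window_weighted hγ suFrobDist_nonneg suFrobDist_le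
    hR₀ suFrobDist_self (win := starWinZd) (K := fun c => K c.1) (fun c y x => hK0 _ _ _) hcontract hq
    (d := fun c y _ => Real.log (1 + (‖y.1 - c.1‖ + 1) / D₀)) (fun c y _ => hreach0 _ _) (fun c x => hKs c.1 x)
    hρ0 hρ1 (fun c x hx => hsum c.1 x hx) (exists_starExhaustionLog hD K) suEntries
    measurableSpace_specialUnitaryGroup_eq_comap zero_le_one hA

/-- **POWER-LAW CLUSTERING OF EVERY GIBBS MEASURE through the star door with LOGARITHMIC reach**, directly in infinite volume: under the
weighted star window bound at rate `q ≥ 0`, received sum `ρ < 1`, reach `log(1 + (‖y − s‖ + 1)/D₀)`, every Gibbs measure `μ` satisfies, for bounded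
measurable `f, g` reading the finite link sets `Δf, Δg` with Frobenius-Lipschitz vectors `δf, δg`:
`|cov_μ(f, g)| ≤ 2(2√N)² · max(1, (dist(Δf,Δg) − 2)/D₀)^{−q} (Σ δf)(Σ δg)` (`dist` = `setDistEdges`; Literature
`DobrushinShlosman.abs_covariance_le_of_window_weighted_exp` with the logarithmic two-set profile `exists_starProfileLog`). [folklore] -/
theorem abs_covariance_le_of_starWindowBoundZd_log {γ : Specification (ZdEdge d) (SUN N)}
    (hγ : IsSpecification γ) {q ρ D₀ : ℝ} (hq : 0 ≤ q) (hD : 0 < D₀) (hρ0 : 0 ≤ ρ) (hρ1 : ρ < 1)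
    (h : StarWindowBoundZdW d N γ q ρ (fun s y => Real.log (1 + (‖y.1 - s‖ + 1) / D₀)) suFrobDist)
    {μ : Measure (LGConfig d (SUN N))} (hμ : IsGibbsMeasure γ μ)
    {f g : LGConfig d (SUN N) → ℝ} (hfm : Measurable f) (hgm : Measurable g) {Bf Bg : ℝ}
    (hBf : ∀ σ, |f σ| ≤ Bf) (hBg : ∀ σ, |g σ| ≤ Bg) {Δf Δg : Finset (ZdEdge d)}
    (hfdep : DependsOn f (Δf : Set (ZdEdge d))) (hgdep : DependsOn g (Δg : Set (ZdEdge d)))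
    {δf δg : ZdEdge d → ℝ} (hδf : IsLipBound suFrobDist f δf) (hδg : IsLipBound suFrobDist g δg) :
    |cov[f, g; μ]| ≤ 2 * (2 * Real.sqrt N) ^ 2 * (max 1 ((setDistEdges Δf Δg - 2) / D₀)) ^ (-q) *
      (∑ x ∈ Δf, δf x) * ∑ y ∈ Δg, δg y := by
  classical
  obtain ⟨K, hK0, hKs, hcontract, hsum⟩ := h
  have hR₀ : (0 : ℝ) ≤ 2 * Real.sqrt N := by positivity
  have hreach0 : ∀ (s : Site d) (y : ZdEdge d), 0 ≤ Real.log (1 + (‖y.1 - s‖ + 1) / D₀) := fun s y =>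
    Real.log_nonneg (by have := div_nonneg (by positivity : (0 : ℝ) ≤ ‖y.1 - s‖ + 1) hD.le; linarith)
  obtain ⟨Λ, ρf, hΔΛ, hout, hunc, hlip, hm⟩ := exists_starProfileLog hD K Δf Δg
  have key := DobrushinShlosman.abs_covariance_le_of_window_weighted_exp hγ suFrobDist_nonneg suFrobDist_le
    hR₀ suFrobDist_self (win := starWinZd) (K := fun c => K c.1) (fun c y x => hK0 _ _ _) hcontract hq
    (d := fun c y _ => Real.log (1 + (‖y.1 - c.1‖ + 1) / D₀)) (fun c y _ => hreach0 _ _) (fun c x => hKs c.1 x)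
    hρ0 hρ1 (fun c x hx => hsum c.1 x hx) hμ hfm hgm hBf hBg hfdep hgdep hδf hδg Λ hΔΛ ρf hout hunc hlip hm
  refine key.trans (le_of_eq ?_)
  have hM : (0 : ℝ) < max 1 ((setDistEdges Δf Δg - 2) / D₀) := lt_of_lt_of_le one_pos (le_max_left _ _)
  have hrw : (max 1 ((setDistEdges Δf Δg - 2) / D₀)) ^ (-q) =
      Real.exp (-(q * Real.log (max 1 ((setDistEdges Δf Δg - 2) / D₀)))) := by
    rw [Real.rpow_def_of_pos hM]; congr 1; ring
  rw [hrw]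

/-- `1 + u ≤ (D₀ + 3) · max(1, (u − 2)/D₀)` for every real `u`, `D₀ > 0`: the logarithmic-profile decay factor dominates the plain power. [folklore] -/
theorem one_add_le_mul_max_one_div {D₀ : ℝ} (u : ℝ) (hD : 0 < D₀) :
    1 + u ≤ (D₀ + 3) * max 1 ((u - 2) / D₀) := by
  rcases le_or_gt u (D₀ + 2) with h | h
  · calc 1 + u ≤ D₀ + 3 := by linarith
      _ = (D₀ + 3) * 1 := (mul_one _).symm
      _ ≤ (D₀ + 3) * max 1 ((u - 2) / D₀) := mul_le_mul_of_nonneg_left (le_max_left _ _) (by linarith)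
  · have h2 : (u - 2) / D₀ ≤ max 1 ((u - 2) / D₀) := le_max_right _ _
    have h3 : 1 + u ≤ (D₀ + 3) * ((u - 2) / D₀) := by
      rw [mul_div_assoc', le_div_iff₀ hD]; nlinarith
    exact h3.trans (mul_le_mul_of_nonneg_left h2 (by linarith))

/-- `max(1, (u − 2)/D₀)^{−q} ≤ (D₀ + 3)^q (1 + u)^{−q}` for `u ≥ 0`, `q ≥ 0`, `D₀ > 0`. [folklore] -/
theorem max_one_div_rpow_neg_le {D₀ u q : ℝ} (hD : 0 < D₀) (hu : 0 ≤ u) (hq : 0 ≤ q) :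
    (max 1 ((u - 2) / D₀)) ^ (-q) ≤ (D₀ + 3) ^ q * (1 + u) ^ (-q) := by
  have hM : (0 : ℝ) < max 1 ((u - 2) / D₀) := lt_of_lt_of_le one_pos (le_max_left _ _)
  have h1u : (0 : ℝ) < 1 + u := by linarith
  have hD3 : (0 : ℝ) < D₀ + 3 := by linarith
  have key := one_add_le_mul_max_one_div u hD
  -- raise to the power `q` and invert
  have hpow : (1 + u) ^ q ≤ (D₀ + 3) ^ q * (max 1 ((u - 2) / D₀)) ^ q := by
    rw [← Real.mul_rpow hD3.le hM.le]; exact Real.rpow_le_rpow h1u.le key hq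
  rw [Real.rpow_neg hM.le, Real.rpow_neg h1u.le]
  have hMq : 0 < (max 1 ((u - 2) / D₀)) ^ q := Real.rpow_pos_of_pos hM q
  have h1q : 0 < (1 + u) ^ q := Real.rpow_pos_of_pos h1u q
  calc ((max 1 ((u - 2) / D₀)) ^ q)⁻¹ = (1 + u) ^ q * (((1 + u) ^ q)⁻¹ * ((max 1 ((u - 2) / D₀)) ^ q)⁻¹) := by
        field_simp
    _ ≤ (D₀ + 3) ^ q * (max 1 ((u - 2) / D₀)) ^ q * (((1 + u) ^ q)⁻¹ * ((max 1 ((u - 2) / D₀)) ^ q)⁻¹) :=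
        mul_le_mul_of_nonneg_right hpow (by positivity)
    _ = (D₀ + 3) ^ q * ((1 + u) ^ q)⁻¹ := by field_simp

/-- **POWER-LAW CLUSTERING, cleaned form**: under the hypotheses of `abs_covariance_le_of_starWindowBoundZd_log`,
`|cov_μ(f, g)| ≤ 2(2√N)² (D₀ + 3)^q (1 + dist(Δf, Δg))^{−q} (Σ δf)(Σ δg)`. [folklore] -/
theorem abs_covariance_le_of_starWindowBoundZd_log' {γ : Specification (ZdEdge d) (SUN N)}
    (hγ : IsSpecification γ) {q ρ D₀ : ℝ} (hq : 0 ≤ q) (hD : 0 < D₀) (hρ0 : 0 ≤ ρ) (hρ1 : ρ < 1)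
    (h : StarWindowBoundZdW d N γ q ρ (fun s y => Real.log (1 + (‖y.1 - s‖ + 1) / D₀)) suFrobDist)
    {μ : Measure (LGConfig d (SUN N))} (hμ : IsGibbsMeasure γ μ)
    {f g : LGConfig d (SUN N) → ℝ} (hfm : Measurable f) (hgm : Measurable g) {Bf Bg : ℝ}
    (hBf : ∀ σ, |f σ| ≤ Bf) (hBg : ∀ σ, |g σ| ≤ Bg) {Δf Δg : Finset (ZdEdge d)}
    (hfdep : DependsOn f (Δf : Set (ZdEdge d))) (hgdep : DependsOn g (Δg : Set (ZdEdge d)))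
    {δf δg : ZdEdge d → ℝ} (hδf : IsLipBound suFrobDist f δf) (hδg : IsLipBound suFrobDist g δg) :
    |cov[f, g; μ]| ≤ 2 * (2 * Real.sqrt N) ^ 2 * ((D₀ + 3) ^ q * (1 + setDistEdges Δf Δg) ^ (-q)) *
      (∑ x ∈ Δf, δf x) * ∑ y ∈ Δg, δg y := by
  have key := abs_covariance_le_of_starWindowBoundZd_log hγ hq hD hρ0 hρ1 h hμ hfm hgm hBf hBg hfdep hgdep hδf hδg
  have hf0 : 0 ≤ ∑ x ∈ Δf, δf x := Finset.sum_nonneg fun x _ => hδf.nonneg x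
  have hg0 : 0 ≤ ∑ y ∈ Δg, δg y := Finset.sum_nonneg fun y _ => hδg.nonneg y
  refine key.trans ?_
  have hcmp := max_one_div_rpow_neg_le (q := q) hD (setDistEdges_nonneg Δf Δg) hq
  have h22 : (0 : ℝ) ≤ 2 * (2 * Real.sqrt N) ^ 2 := by positivity
  exact mul_le_mul_of_nonneg_right (mul_le_mul_of_nonneg_right (mul_le_mul_of_nonneg_left hcmp h22) hf0) hg0

end Summit.Ventures.YMGap.RobustBall

end
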